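import Summits.NavierStokesRegularity.FluidComputer.GateBudgetNecessity
import Summits.NavierStokesRegularity.FluidComputer.RotorKnobCritical
import HarnessLib

/-!
# What no tuning can beat, part 18: THE LEVELS FROM THE DYNAMICS — the trigger time, the
# clock's surrender and the clock's death as TYPED hitting times; the pulse window of a member

Cell `pub-fluidc`, blueprint seat bp1 (gen 29, second item); same namespace and conventions as
parts 1–17 (`GateBudget*.lean`); imports part 12 (`GateBudgetNecessity`, hence parts 1–11: the
radius, no-return, rise, transit and decay laws of the pulse) and `RotorKnobCritical` (gen 22: the
trigger phase of Theorem 5.3 for the two-scale family under POLYNOMIAL hypotheses). Modes `0 = a`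
input, `1 = b` clock, `2 = c` catalyst (`u = c/ρ²`), `3 = d` transfer, `4 = ã` output;
`σ_knob = ρ²/ε`. HONEST FRAMING (verbatim): low prior, high value-of-information experiment on
Tao's machine paradigm; NOT a claim that NS blows up. Nothing is proved about Navier–Stokes.

## What this part records (SPEC-INPUT-bp1 §X item (1): the LEVEL hypotheses of parts 12–17
## discharged from the dynamics, on ONE member, with the times constructed)

Parts 10–17 are WINDOW laws: entry `s₀`, exit `T`, the armed radius, the dead clock level and the
exit catalyst level are hypotheses "at common times"; no hitting time was constructed. Here it is.
* §54 ENTRY. `knob_entry_levels`: under the polynomial trigger hypotheses (`16 ≤ K`,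
  `48 log K ≤ M ≤ K¹⁰`, `ε² ≤ 1/(6K²⁰)`, `0 < ρ² ≤ ε`, `Mρ⁴ ≤ ε²` — NO exponential scale
  separation, so the whole dud-lattice range `σ_knob M ≤ 2` is covered) a member has a critical
  time `s₀ ∈ [1, 3/2]` (first hitting time of `u = K⁻¹⁰`) with `c ≤ ρ²/K¹⁰` on `[0,s₀]`,
  `c(s₀) = ρ²/K¹⁰`, `|b(s₀) - εs₀| ≤ 17εs₀/K²⁰`, `|a(s₀) - 1| ≤ 8/K²⁰`, `|d|, |ã| ≤ 3/K¹⁰` on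
  `[0,s₀]`; `knob_entry_dose` (`0 ≤ C(s₀) - C(0) ≤ ℓρ²s₀` if `c ≤ ℓρ²` on `[0,s₀]`: the pre-entry
  carrier phase is `≤ 3/(2K¹⁰)`); `knob_trigger_pos` (a lit catalyst stays lit);
  `knob_output_growth` (`ã(t) ≤ ã(s) + K(t - s)`).
* §55 THE PULSE WINDOW. `knob_clock_window`: with the clock ARMED at `s₀ ≥ 0` (`b(s₀) > β > 0`,
  `c(s₀) ≥ λ₁ρ²`), an armed horizon `[s₀, s₀+H]` (`ϱ² + 2ε²((s₀+H)² - s₀²) ≤ b(s₀)² + c(s₀)²`,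
  radius law of part 10), a transit level `γ ≥ 0`, `γ² + β² ≤ ϱ²`, `Mγ² > ε²`, and the DURATION
  HYPOTHESIS `Δ_A + Δ_B < H`, `Δ_A = (ε/(Mβ))log(2ε(s₀+H)/(λ₁ρ²))` (rise residence, part 11),
  `Δ_B = 2εβ/(Mγ² - ε²)` (transit, part 11): THERE ARE TIMES `s₀ < t₁ < t₂`, `t₂ - s₀ ≤ Δ_A + Δ_B`,
  with the clock ALIVE `b ≥ β` on `[s₀,t₁]`, `b(t₁) = β` (first hitting time), IN TRANSIT
  `|b| ≤ β` on `[t₁,t₂]`, `b(t₂) = -β` (first hitting time), DEAD `b ≤ -β` on `[t₂, s₀+H]`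
  (no-return law), the pair ARMED and the catalyst LIT on `[s₀, s₀+H]`. `knob_pulse_window`: with
  moreover an exit level `0 < λ ≤ λ₁`, `Δ_C = (ε/(Mβ))log(2ε(s₀+H)/(λρ²))` and
  `Δ_A + Δ_B + Δ_C < H`, the catalyst is DOUSED at `T = t₂ + Δ_C < s₀ + H`:
  `c(T) ≤ (λ + εe^{-M}/(Mβ))ρ²` (pulse decay, part 5) — the window/level hypotheses of parts 12,
  14, 16, 17 (`knob_pulse_duration`, `knob_phase_tracking_*`, `knob_swing_lower`,
  `knob_lattice_dud`) as THEOREMS about one trajectory.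

READING. The pulse of the two-scale gate is now a typed three-act play on every member of the
dud-lattice range: the clock, charged to `≈ ε√2` by the critical time, surrenders (`t₁`), is
crossed (`t₂`) and stays dead within `Δ_A + Δ_B = O(log(K¹⁰/σ_knob)/M)`, after which the catalyst
douses itself back to its entry level by `T`; the carrier meanwhile turns by `Φ ≈ π/(σ_knob M)`
(part 16). Part 19 fixes the constants (`H = 1/16`, `β = ε/4`, `ϱ = 7ε/10`, `γ = 13ε/20`,
`λ = K⁻¹⁰`) and reads off the level list of part 17's `knob_lattice_dud` from §54–§55.

HONEST LIMITS. One exact trajectory from the exact datum (5.6); the duration hypothesis is an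
explicit largeness condition on `M` against `log(K¹⁰/σ_knob)` (ample for Tao's `M = K¹⁰`; NOT
discharged for small `M`); the exit level is the entry level `K⁻¹⁰`; `ã(T)` is bounded only by
`ã(s₀) + K(T - s₀)`, so part 16's drift `D` needs `K(T - s₀) ≪ 1`, i.e. `M ≫ K log(K/σ_knob)`
(true for `M = K¹⁰`, false at toy scale); no second pulse is excluded after `s₀ + H`; nothing
about the cascade or Navier–Stokes; `0` named facts, `0` sorry.
[cite: Tao2016AveragedNS, §5.5 Theorem 5.3, (5.5), (5.6), (b-eq), (c-eq), proof (ob-2), (tcable)]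
-/

noncomputable section

namespace Summit.NavierStokesRegularity.FluidComputer.GateBudget

open Real Set Filter Topology
open Literature.Analysis.FluidPDE.Tao2016AveragedNS
open Literature.Analysis.FluidPDE.Tao2016AveragedNS.Thm53 (exists_hitTime init_c)

variable {K M ε ρ : ℝ} {X : ℝ → Fin 5 → ℝ} {C : ℝ → ℝ}

/-! ## §54 Entry: the critical time and the entry levels under polynomial hypotheses -/

/-- **ENTRY LEVELS AT THE CRITICAL TIME, knob family.** Along `rotorCircuit K M ε ρ` from (5.6)
with `16 ≤ K`, `48 log K ≤ M ≤ K¹⁰`, `0 < ε`, `ε² ≤ 1/(6K²⁰)`, `0 < ρ² ≤ ε`, `Mρ⁴ ≤ ε²` (the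
POLYNOMIAL trigger hypotheses of gen 22): the first hitting time `s₀` of the level `ρ²/K¹⁰` by the
catalyst has `1 ≤ s₀ ≤ 3/2`, `c ≤ ρ²/K¹⁰` on `[0,s₀]`, `c(s₀) = ρ²/K¹⁰`,
`|b(s₀) - εs₀| ≤ 17εs₀/K²⁰`, `|a(s₀) - 1| ≤ 8/K²⁰`, `|d|, |ã| ≤ 3/K¹⁰` on `[0,s₀]`
(`tc_window`, `b_linear`, `a_near_one`, `de_small`).
[cite: Tao2016AveragedNS, §5.5 Theorem 5.3 proof (ob-2), (dora), (able), (tcable)] -/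
theorem knob_entry_levels (hX : ∀ t, HasDerivAt X (RotorKnob.rotorCircuit K M ε ρ (X t)) t)
    (h0 : X 0 = delayInit) (hε : 0 < ε) (hρ : 0 < ρ) (hρε : ρ ^ 2 ≤ ε) (hM : 0 < M)
    (hMK : M ≤ K ^ 10) (hK : 16 ≤ K) (hML : 48 * Real.log K ≤ M)
    (hεK : ε ^ 2 ≤ 1 / (6 * K ^ 20)) (hMρ : M * ρ ^ 4 ≤ ε ^ 2) :
    ∃ s₀ : ℝ, 1 ≤ s₀ ∧ s₀ ≤ 3 / 2 ∧ (∀ t ∈ Icc 0 s₀, X t 2 ≤ ρ ^ 2 / K ^ 10) ∧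
      X s₀ 2 = ρ ^ 2 / K ^ 10 ∧ |X s₀ 1 - ε * s₀| ≤ 17 * ε / K ^ 20 * s₀ ∧
      |X s₀ 0 - 1| ≤ 8 / K ^ 20 ∧
      (∀ t ∈ Icc 0 s₀, |X t 3| ≤ 3 / K ^ 10 ∧ |X t 4| ≤ 3 / K ^ 10) := by
  have hK1 : 1 ≤ K := by linarith
  have hK0 : 0 < K := by linarith
  obtain ⟨τ, hτ0, hτ2, hcτ, hτeq⟩ := exists_hitTime (RotorKnob.continuous_traj hX 2)
    (θ := ρ ^ 2 / K ^ 10) (T := 2) two_pos (by rw [init_c h0]; positivity)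
  obtain ⟨-, -, hτ1, hτ32, hcτeq⟩ :=
    RotorKnob.tc_window hX h0 hε hρ hρε hM hMK hK hML hεK hMρ hτ0 hτ2 hcτ hτeq
  exact ⟨τ, hτ1, hτ32, fun t ht => hcτ t ht.1 ht.2, hcτeq,
    RotorKnob.b_linear hX h0 hε hρ hρε hM hK1 hτ2 hεK hMρ hcτ ⟨hτ0.le, le_rfl⟩,
    RotorKnob.a_near_one hX h0 hε hρ hρε hM.le hK1 hτ2 hεK hcτ ⟨hτ0.le, le_rfl⟩,
    fun t ht => RotorKnob.de_small hX h0 hρ hK0 hτ2 hcτ ht⟩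

/-- **PRE-ENTRY DOSE.** Along `rotorCircuit K M ε ρ` from (5.6) (`0 < ρ`): if `c ≤ ℓρ²` on
`[0,s₀]` (`s₀ ≥ 0`) then every primitive `C` of the catalyst gains `0 ≤ C(s₀) - C(0)` and
`|(C(s₀) - C(0))/ρ²| ≤ ℓs₀` (mean value; `c ≥ 0`). With §54's `ℓ = K⁻¹⁰`, `s₀ ≤ 3/2` the pre-entry
carrier phase `Φ₀` of part 16 is at most `3/(2K¹⁰)`. [cite: Tao2016AveragedNS, §5.5 proof (ob-2)] -/
theorem knob_entry_dose (hX : ∀ t, HasDerivAt X (RotorKnob.rotorCircuit K M ε ρ (X t)) t)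
    (h0 : X 0 = delayInit) (hρ : 0 < ρ) (hC : ∀ t, HasDerivAt C (X t 2) t) {s₀ ℓ : ℝ}
    (hs₀ : 0 ≤ s₀) (hc : ∀ t ∈ Icc 0 s₀, X t 2 ≤ ℓ * ρ ^ 2) :
    0 ≤ C s₀ - C 0 ∧ |(C s₀ - C 0) / ρ ^ 2| ≤ ℓ * s₀ := by
  have hdiff : Differentiable ℝ C := fun t => (hC t).differentiableAt
  have hderiv : ∀ t, deriv C t = X t 2 := fun t => (hC t).deriv
  have hcont : ContinuousOn C (Icc 0 s₀) := hdiff.continuous.continuousOn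
  have hdon : DifferentiableOn ℝ C (interior (Icc 0 s₀)) := hdiff.differentiableOn
  have hup : C s₀ - C 0 ≤ ℓ * ρ ^ 2 * (s₀ - 0) :=
    (convex_Icc 0 s₀).image_sub_le_mul_sub_of_deriv_le hcont hdon
      (fun x hx => by rw [hderiv]; exact hc x (interior_subset hx))
      0 (left_mem_Icc.2 hs₀) s₀ (right_mem_Icc.2 hs₀) hs₀
  have hlo : 0 * (s₀ - 0) ≤ C s₀ - C 0 :=
    (convex_Icc 0 s₀).mul_sub_le_image_sub_of_le_deriv hcont hdon
      (fun x hx => by rw [hderiv]; exact RotorKnob.c_nonneg hX h0 (interior_subset hx).1)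
      0 (left_mem_Icc.2 hs₀) s₀ (right_mem_Icc.2 hs₀) hs₀
  have hρ2 : 0 < ρ ^ 2 := by positivity
  have hlo' : 0 ≤ C s₀ - C 0 := by simpa using hlo
  refine ⟨hlo', ?_⟩
  rw [abs_div, abs_of_pos hρ2, div_le_iff₀ hρ2, abs_of_nonneg hlo']
  nlinarith [hup]

/-- **A LIT CATALYST STAYS LIT.** Along `rotorCircuit K M ε ρ` from (5.6) (`0 < ε`, `0 ≤ M`):
`c(s) > 0` at some `s ≥ 0` gives `c(t) > 0` for every `t ≥ s` — part 10's rise law with the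
universal clock floor `b ≥ -1`: `c(t) ≥ c(s)e^{-ε⁻¹M(t-s)}`. (The hypothesis "`c > 0` on `[s₀,T]`"
of parts 14/16 is automatic.) [cite: Tao2016AveragedNS, §5.5 (c-eq), (est)] -/
theorem knob_trigger_pos (hX : ∀ t, HasDerivAt X (RotorKnob.rotorCircuit K M ε ρ (X t)) t)
    (h0 : X 0 = delayInit) (hε : 0 < ε) (hM : 0 ≤ M) {s t : ℝ} (hs : 0 ≤ s) (hst : s ≤ t)
    (hcs : 0 < X s 2) : 0 < X t 2 := by
  have hb : ∀ r ∈ Icc s t, (-1 : ℝ) ≤ X r 1 := fun r _ =>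
    (abs_le.1 (RotorKnob.traj_abs_le_one hX h0 r 1)).1
  rw [RotorKnob.rotorCircuit_eq_fiveGate] at hX
  have hσ : 0 ≤ ρ ^ 2 * exp (-M) := by positivity
  have hμ : 0 ≤ ε⁻¹ * M := by positivity
  have h := trigger_rise hX h0 hσ hμ hs hb (s := s) (t := t) ⟨le_rfl, hst⟩ ⟨hst, le_rfl⟩ hst
  exact lt_of_lt_of_le (mul_pos hcs (exp_pos _)) h

/-- **OUTPUT GROWTH.** Along `rotorCircuit K M ε ρ` from (5.6) (`K ≥ 0`): `ã(t) ≤ ã(s) + K(t-s)`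
for `s ≤ t` (`∂ₜã = Kd² ≤ K`). (Feeds the drift `L_T = ε + ρ²e^{-M} + Kã(T)` of part 16 with
`ã(T) ≤ 3/K¹⁰ + K(T - s₀)`.) [cite: Tao2016AveragedNS, §5.5 (5.5), (est)] -/
theorem knob_output_growth (hX : ∀ t, HasDerivAt X (RotorKnob.rotorCircuit K M ε ρ (X t)) t)
    (h0 : X 0 = delayInit) (hK : 0 ≤ K) {s t : ℝ} (hst : s ≤ t) :
    X t 4 ≤ X s 4 + K * (t - s) := by
  have hd : ∀ r, HasDerivAt (fun r => X r 4) (K * X r 3 ^ 2) r := RotorKnob.hasDerivAt_e hX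
  have hdiff : Differentiable ℝ fun r => X r 4 := fun r => (hd r).differentiableAt
  have hle : ∀ r, K * X r 3 ^ 2 ≤ K := fun r => by
    have := mul_le_mul_of_nonneg_left (RotorKnob.traj_sq_le_one hX h0 r 3) hK
    linarith
  have h := (convex_Icc s t).image_sub_le_mul_sub_of_deriv_le hdiff.continuous.continuousOn
    hdiff.differentiableOn (C := K) (fun r _ => by rw [(hd r).deriv]; exact hle r)
    s (left_mem_Icc.2 hst) t (right_mem_Icc.2 hst) hst
  linarith

/-! ## §55 The pulse window: the clock surrenders, is crossed and stays dead; the catalyst douses -/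

/-- **THE CLOCK WINDOW FROM THE DYNAMICS (hitting times typed), knob family.** Along
`rotorCircuit K M ε ρ` from (5.6) (`0 < ρ² ≤ ε`, `0 < M`), let the clock be ARMED at `s₀ ≥ 0`:
`b(s₀) > β > 0`, `c(s₀) ≥ λ₁ρ²` (`λ₁ > 0`); let `[s₀, s₀+H]` be an armed horizon,
`ϱ² + 2ε²((s₀+H)² - s₀²) ≤ b(s₀)² + c(s₀)²`; let `γ ≥ 0`, `γ² + β² ≤ ϱ²`, `Mγ² > ε²`; put
`Δ_A = (ε/(Mβ))log(2ε(s₀+H)/(λ₁ρ²))`, `Δ_B = 2εβ/(Mγ² - ε²)` and assume `Δ_A + Δ_B < H`. Then there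
are times `s₀ < t₁ < t₂`, `t₂ - s₀ ≤ Δ_A + Δ_B`, with `b ≥ β` on `[s₀,t₁]`, `b(t₁) = β` (the rise
residence bounds the first hitting time of `β`); `|b| ≤ β` on `[t₁,t₂]`, `b(t₂) = -β` (no return
above `β`; the transit law bounds the first hitting time of `-β`); `b ≤ -β` on `[t₂, s₀+H]` (a dead
clock stays dead while armed); `b² + c² ≥ ϱ²` and `c > 0` on `[s₀, s₀+H]`.
[cite: Tao2016AveragedNS, §5.5 Theorem 5.3, (5.5), (b-eq), (c-eq), proof (ob-2)] -/
theorem knob_clock_window (hX : ∀ t, HasDerivAt X (RotorKnob.rotorCircuit K M ε ρ (X t)) t)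
    (h0 : X 0 = delayInit) (hε : 0 < ε) (hρ : 0 < ρ) (hρε : ρ ^ 2 ≤ ε) (hM : 0 < M)
    {s₀ H β ϱ γ lam₁ : ℝ} (hs₀ : 0 ≤ s₀) (hH : 0 < H) (hβ : 0 < β) (hβb : β < X s₀ 1)
    (hγ : 0 ≤ γ) (hγϱ : γ ^ 2 + β ^ 2 ≤ ϱ ^ 2) (hγε : ε ^ 2 < M * γ ^ 2)
    (harm : ϱ ^ 2 + 2 * ε ^ 2 * ((s₀ + H) ^ 2 - s₀ ^ 2) ≤ X s₀ 1 ^ 2 + X s₀ 2 ^ 2)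
    (hlam₁ : 0 < lam₁) (hu₁ : lam₁ * ρ ^ 2 ≤ X s₀ 2)
    (hΔ : ε * log (2 * ε * (s₀ + H) / (lam₁ * ρ ^ 2)) / (M * β)
      + 2 * ε * β / (M * γ ^ 2 - ε ^ 2) < H) :
    ∃ t₁ t₂ : ℝ, s₀ < t₁ ∧ t₁ < t₂ ∧
      t₂ - s₀ ≤ ε * log (2 * ε * (s₀ + H) / (lam₁ * ρ ^ 2)) / (M * β)
        + 2 * ε * β / (M * γ ^ 2 - ε ^ 2) ∧
      (∀ t ∈ Icc s₀ t₁, β ≤ X t 1) ∧ X t₁ 1 = β ∧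
      (∀ t ∈ Icc t₁ t₂, |X t 1| ≤ β) ∧ X t₂ 1 = -β ∧
      (∀ t ∈ Icc t₂ (s₀ + H), X t 1 ≤ -β) ∧
      (∀ t ∈ Icc s₀ (s₀ + H), ϱ ^ 2 ≤ X t 1 ^ 2 + X t 2 ^ 2) ∧
      (∀ t ∈ Icc s₀ (s₀ + H), 0 < X t 2) := by
  have hρ2 : 0 < ρ ^ 2 := by positivity
  have hMβ : 0 < M * β := mul_pos hM hβ
  have hcs₀ : 0 < X s₀ 2 := lt_of_lt_of_le (by positivity) hu₁
  have hc1 : Continuous fun s => X s 1 := RotorKnob.continuous_traj hX 1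
  have hcpos : ∀ t ∈ Icc s₀ (s₀ + H), 0 < X t 2 := fun t ht =>
    knob_trigger_pos hX h0 hε hM.le hs₀ ht.1 hcs₀
  have hcnn : ∀ t, s₀ ≤ t → 0 ≤ X t 2 := fun t ht => RotorKnob.c_nonneg hX h0 (hs₀.trans ht)
  have hXf := hX
  rw [RotorKnob.rotorCircuit_eq_fiveGate] at hXf
  obtain ⟨hσ0, hσε⟩ := knob_seed_le hε hρε hM.le
  have hμ : 0 < ε⁻¹ * M := by positivity
  -- the armed horizon (radius law, part 10) and the no-return threshold
  have harmw : ∀ t ∈ Icc s₀ (s₀ + H), ϱ ^ 2 ≤ X t 1 ^ 2 + X t 2 ^ 2 := by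
    have hsq : 0 ≤ (s₀ + H) ^ 2 - s₀ ^ 2 := by
      rw [show (s₀ + H) ^ 2 - s₀ ^ 2 = H * (2 * s₀ + H) by ring]; positivity
    have hcoef : ε * (ε + ρ ^ 2 * exp (-M)) ≤ 2 * ε ^ 2 := by
      have := mul_le_mul_of_nonneg_left hσε hε.le
      linarith [sq ε]
    have hϱ : ϱ ^ 2 + ε * (ε + ρ ^ 2 * exp (-M)) * ((s₀ + H) ^ 2 - s₀ ^ 2) ≤
        X s₀ 1 ^ 2 + X s₀ 2 ^ 2 := by
      have := mul_le_mul_of_nonneg_right hcoef hsq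
      linarith
    exact fun t ht => armed_window hXf h0 hε.le hσ0 hs₀ hϱ ht
  have hnoret : ε < ε⁻¹ * M * (ϱ ^ 2 - β ^ 2) := by
    have h1 : M * γ ^ 2 ≤ M * (ϱ ^ 2 - β ^ 2) := mul_le_mul_of_nonneg_left (by linarith) hM.le
    rw [mul_assoc, lt_inv_mul_iff₀ hε, ← pow_two]
    linarith
  -- the budget `c(s₀) ≤ 2εs₀ ≤ 2ε(s₀+H)`: the duration `Δ_A` is non-negative
  have hbud : X s₀ 2 ≤ 2 * ε * (s₀ + H) := by
    have h := c_le hXf h0 hε.le hσ0 hs₀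
    have h1 := mul_le_mul_of_nonneg_right (by linarith : ε + ρ ^ 2 * exp (-M) ≤ 2 * ε) hs₀
    have h2 := mul_le_mul_of_nonneg_left (by linarith : s₀ ≤ s₀ + H) (by positivity : (0:ℝ) ≤ 2 * ε)
    linarith
  have hargA : 1 ≤ 2 * ε * (s₀ + H) / (lam₁ * ρ ^ 2) := by
    rw [le_div_iff₀ (by positivity), one_mul]; exact hu₁.trans hbud
  have hΔA0 : 0 ≤ ε * log (2 * ε * (s₀ + H) / (lam₁ * ρ ^ 2)) / (M * β) :=
    div_nonneg (mul_nonneg hε.le (log_nonneg hargA)) hMβ.le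
  have hγM : 0 < M * γ ^ 2 - ε ^ 2 := by linarith
  have hΔB0 : 0 ≤ 2 * ε * β / (M * γ ^ 2 - ε ^ 2) := div_nonneg (by positivity) hγM.le
  -- ACT ONE: the clock surrenders (`t₁ = s₀ + τA`, the first hitting time of `β` from above)
  have huA : Continuous fun r => -X (s₀ + r) 1 :=
    (hc1.comp (continuous_const.add continuous_id)).neg
  obtain ⟨τA, hτA0, hτAH, hAge, hAeq⟩ := exists_hitTime huA (θ := -β) (T := H) hH
    (by show -X (s₀ + 0) 1 < -β; rw [add_zero]; linarith)
  have halive : ∀ t ∈ Icc s₀ (s₀ + τA), β ≤ X t 1 := by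
    intro t ht
    have h : -X (s₀ + (t - s₀)) 1 ≤ -β := hAge (t - s₀) (by linarith [ht.1]) (by linarith [ht.2])
    rw [add_sub_cancel] at h
    linarith
  have hτAΔ : τA ≤ ε * log (2 * ε * (s₀ + H) / (lam₁ * ρ ^ 2)) / (M * β) := by
    have h1 := knob_rise_residence hX h0 hε hρ hρε hM hs₀ hβ halive (s := s₀) (t := s₀ + τA)
      ⟨le_rfl, by linarith⟩ ⟨by linarith, le_rfl⟩ (by linarith) hlam₁ hu₁
    have hlog : log (2 * ε * (s₀ + τA) / (lam₁ * ρ ^ 2)) ≤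
        log (2 * ε * (s₀ + H) / (lam₁ * ρ ^ 2)) :=
      log_le_log (by positivity) (by gcongr)
    have h2 := div_le_div_of_nonneg_right (mul_le_mul_of_nonneg_left hlog hε.le) hMβ.le
    linarith
  have hτAltH : τA < H := by linarith
  have hb1 : X (s₀ + τA) 1 = β := by
    have h : -X (s₀ + τA) 1 = -β := hAeq hτAltH
    linarith
  -- no return above `β` after `t₁` while armed (part 10)
  have hbelow : ∀ t ∈ Icc (s₀ + τA) (s₀ + H), X t 1 ≤ β := fun t ht =>
    clock_no_return hXf h0 hε.le hμ.le
      (fun r hr => harmw r ⟨by linarith [hr.1, hτA0.le], hr.2⟩) hnoret hb1.le ht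
  -- ACT TWO: the clock is crossed (`t₂ = t₁ + τB`, the first hitting time of `-β`)
  have huB : Continuous fun r => -X (s₀ + τA + r) 1 :=
    (hc1.comp (continuous_const.add continuous_id)).neg
  obtain ⟨τB, hτB0, hτBH, hBge, hBeq⟩ := exists_hitTime huB (θ := β) (T := H - τA)
    (by linarith) (by show -X (s₀ + τA + 0) 1 < β; rw [add_zero, hb1]; linarith)
  have hnotdead : ∀ t ∈ Icc (s₀ + τA) (s₀ + τA + τB), -β ≤ X t 1 := by
    intro t ht
    have h : -X (s₀ + τA + (t - (s₀ + τA))) 1 ≤ β :=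
      hBge (t - (s₀ + τA)) (by linarith [ht.1]) (by linarith [ht.2])
    rw [add_sub_cancel] at h
    linarith
  have hband : ∀ t ∈ Icc (s₀ + τA) (s₀ + τA + τB), |X t 1| ≤ β := fun t ht =>
    abs_le.2 ⟨hnotdead t ht, hbelow t ⟨ht.1, by linarith [ht.2]⟩⟩
  have hcγ : ∀ t ∈ Icc (s₀ + τA) (s₀ + τA + τB), γ ≤ X t 2 := by
    intro t ht
    have hr := harmw t ⟨by linarith [ht.1, hτA0.le], by linarith [ht.2]⟩
    have hb := abs_le.1 (hband t ht)
    have hbsq : X t 1 ^ 2 ≤ β ^ 2 := sq_le_sq' hb.1 hb.2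
    have hc0 : 0 ≤ X t 2 := hcnn t (by linarith [ht.1, hτA0.le])
    exact (sq_le_sq₀ hγ hc0).1 (by linarith)
  have hτBΔ : τB ≤ 2 * ε * β / (M * γ ^ 2 - ε ^ 2) := by
    have h := knob_clock_transit hX h0 hε hM.le hγ hγε hcγ (s := s₀ + τA) (t := s₀ + τA + τB)
      ⟨le_rfl, by linarith⟩ ⟨by linarith, le_rfl⟩ (by linarith) hb1.le
      (hnotdead (s₀ + τA + τB) ⟨by linarith, le_rfl⟩)
    linarith
  have hτBlt : τB < H - τA := by linarith
  have hb2 : X (s₀ + τA + τB) 1 = -β := by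
    have h : -X (s₀ + τA + τB) 1 = β := hBeq hτBlt
    linarith
  -- the clock stays dead while armed (part 10)
  have hdead : ∀ t ∈ Icc (s₀ + τA + τB) (s₀ + H), X t 1 ≤ -β := fun t ht =>
    clock_stays_dead hXf h0 hε.le hμ.le
      (fun r hr => harmw r ⟨by linarith [hr.1, hτA0.le, hτB0.le], hr.2⟩) hnoret hb2.le ht
  exact ⟨s₀ + τA, s₀ + τA + τB, by linarith, by linarith, by linarith, halive, hb1, hband, hb2,
    hdead, harmw, hcpos⟩

/-- **THE PULSE WINDOW FROM THE DYNAMICS, knob family.** In the setting of `knob_clock_window`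
let moreover `0 < λ ≤ λ₁` be an exit level, `Δ_C = (ε/(Mβ))log(2ε(s₀+H)/(λρ²))`, and assume
`Δ_A + Δ_B + Δ_C < H`. Then there are times `s₀ < t₁ < t₂ ≤ T`, `T - s₀ ≤ Δ_A + Δ_B + Δ_C`,
`T < s₀ + H`, with the clock alive / in transit / dead as in `knob_clock_window` and the catalyst
DOUSED at `T = t₂ + Δ_C`: `c(T) ≤ (λ + εe^{-M}/(Mβ))ρ²` (pulse decay of part 5 from the budget
`c(t₂) ≤ 2ε(s₀+H)`, floor `σ/(μβ) = ρ²·εe^{-M}/(Mβ)`); `b² + c² ≥ ϱ²`, `c > 0` on `[s₀, s₀+H]`.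
[cite: Tao2016AveragedNS, §5.5 Theorem 5.3, (5.5), (b-eq), (c-eq), proof (ob-2)] -/
theorem knob_pulse_window (hX : ∀ t, HasDerivAt X (RotorKnob.rotorCircuit K M ε ρ (X t)) t)
    (h0 : X 0 = delayInit) (hε : 0 < ε) (hρ : 0 < ρ) (hρε : ρ ^ 2 ≤ ε) (hM : 0 < M)
    {s₀ H β ϱ γ lam₁ lam : ℝ} (hs₀ : 0 ≤ s₀) (hH : 0 < H) (hβ : 0 < β) (hβb : β < X s₀ 1)
    (hγ : 0 ≤ γ) (hγϱ : γ ^ 2 + β ^ 2 ≤ ϱ ^ 2) (hγε : ε ^ 2 < M * γ ^ 2)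
    (harm : ϱ ^ 2 + 2 * ε ^ 2 * ((s₀ + H) ^ 2 - s₀ ^ 2) ≤ X s₀ 1 ^ 2 + X s₀ 2 ^ 2)
    (hu₁ : lam₁ * ρ ^ 2 ≤ X s₀ 2) (hlam : 0 < lam) (hlam1 : lam ≤ lam₁)
    (hΔ : ε * log (2 * ε * (s₀ + H) / (lam₁ * ρ ^ 2)) / (M * β)
      + 2 * ε * β / (M * γ ^ 2 - ε ^ 2)
      + ε * log (2 * ε * (s₀ + H) / (lam * ρ ^ 2)) / (M * β) < H) :
    ∃ t₁ t₂ T : ℝ, s₀ < t₁ ∧ t₁ < t₂ ∧ t₂ ≤ T ∧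
      T - s₀ ≤ ε * log (2 * ε * (s₀ + H) / (lam₁ * ρ ^ 2)) / (M * β)
        + 2 * ε * β / (M * γ ^ 2 - ε ^ 2)
        + ε * log (2 * ε * (s₀ + H) / (lam * ρ ^ 2)) / (M * β) ∧
      T < s₀ + H ∧
      (∀ t ∈ Icc s₀ t₁, β ≤ X t 1) ∧ X t₁ 1 = β ∧
      (∀ t ∈ Icc t₁ t₂, |X t 1| ≤ β) ∧ X t₂ 1 = -β ∧
      (∀ t ∈ Icc t₂ (s₀ + H), X t 1 ≤ -β) ∧
      X T 2 ≤ (lam + ε * exp (-M) / (M * β)) * ρ ^ 2 ∧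
      (∀ t ∈ Icc s₀ (s₀ + H), ϱ ^ 2 ≤ X t 1 ^ 2 + X t 2 ^ 2) ∧
      (∀ t ∈ Icc s₀ (s₀ + H), 0 < X t 2) := by
  obtain ⟨ΔC, hΔC⟩ : ∃ x, x = ε * log (2 * ε * (s₀ + H) / (lam * ρ ^ 2)) / (M * β) := ⟨_, rfl⟩
  rw [← hΔC] at hΔ ⊢
  have hρ2 : 0 < ρ ^ 2 := by positivity
  have hMβ : 0 < M * β := mul_pos hM hβ
  have hlam₁ : 0 < lam₁ := lt_of_lt_of_le hlam hlam1
  have hXf := hX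
  rw [RotorKnob.rotorCircuit_eq_fiveGate] at hXf
  obtain ⟨hσ0, hσε⟩ := knob_seed_le hε hρε hM.le
  have hμ : 0 < ε⁻¹ * M := by positivity
  -- the budget `c ≤ 2εt ≤ 2ε(s₀+H)` on the horizon: `Δ_C ≥ 0`
  have hbudget : ∀ t, 0 ≤ t → t ≤ s₀ + H → X t 2 ≤ 2 * ε * (s₀ + H) := by
    intro t ht0 htH
    have h := c_le hXf h0 hε.le hσ0 ht0
    have h1 := mul_le_mul_of_nonneg_right (by linarith : ε + ρ ^ 2 * exp (-M) ≤ 2 * ε) ht0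
    have h2 := mul_le_mul_of_nonneg_left htH (by positivity : (0:ℝ) ≤ 2 * ε)
    linarith
  have hyC : 0 < 2 * ε * (s₀ + H) / (lam * ρ ^ 2) := by positivity
  have hΔC0 : 0 ≤ ΔC := by
    have harg : 1 ≤ 2 * ε * (s₀ + H) / (lam * ρ ^ 2) := by
      rw [le_div_iff₀ (by positivity), one_mul]
      have : lam * ρ ^ 2 ≤ lam₁ * ρ ^ 2 := mul_le_mul_of_nonneg_right hlam1 hρ2.le
      exact this.trans (hu₁.trans (hbudget s₀ hs₀ (by linarith)))
    rw [hΔC]; exact div_nonneg (mul_nonneg hε.le (log_nonneg harg)) hMβ.le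
  -- acts one and two
  obtain ⟨t₁, t₂, h01, h12, ht₂, halive, hb1, hband, hb2, hdead, harmw, hcpos⟩ :=
    knob_clock_window hX h0 hε hρ hρε hM hs₀ hH hβ hβb hγ hγϱ hγε harm hlam₁ hu₁ (by linarith)
  -- ACT THREE: the catalyst douses (pulse decay, part 5) by `T = t₂ + Δ_C`
  have ht₂0 : 0 ≤ t₂ := by linarith
  have hTH : t₂ + ΔC < s₀ + H := by linarith
  have hdecay := pulse_decay hXf h0 hσ0 hμ ht₂0 hβ hdead (t := t₂ + ΔC) ⟨by linarith, hTH.le⟩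
  have hprod : ε⁻¹ * M * β * (t₂ + ΔC - t₂) = log (2 * ε * (s₀ + H) / (lam * ρ ^ 2)) := by
    rw [add_sub_cancel_left, hΔC]
    calc ε⁻¹ * M * β * (ε * log (2 * ε * (s₀ + H) / (lam * ρ ^ 2)) / (M * β))
        = ε⁻¹ * ε * log (2 * ε * (s₀ + H) / (lam * ρ ^ 2)) * (M * β / (M * β)) := by ring
      _ = log (2 * ε * (s₀ + H) / (lam * ρ ^ 2)) := by
          rw [inv_mul_cancel₀ hε.ne', div_self hMβ.ne']; ring
  have hexp : exp (-(ε⁻¹ * M * β * (t₂ + ΔC - t₂))) = lam * ρ ^ 2 / (2 * ε * (s₀ + H)) := by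
    rw [hprod, exp_neg, exp_log hyC, inv_div]
  have hfloor : ρ ^ 2 * exp (-M) / (ε⁻¹ * M * β) = ε * exp (-M) / (M * β) * ρ ^ 2 := by
    rw [div_eq_mul_inv, mul_inv, mul_inv, inv_inv]; ring
  have hcT : X (t₂ + ΔC) 2 ≤ (lam + ε * exp (-M) / (M * β)) * ρ ^ 2 := by
    have hct₂ : X t₂ 2 ≤ 2 * ε * (s₀ + H) := hbudget t₂ ht₂0 (by linarith)
    have hne : 2 * ε * (s₀ + H) ≠ 0 := by positivity
    have h1 : X t₂ 2 * exp (-(ε⁻¹ * M * β * (t₂ + ΔC - t₂))) ≤ lam * ρ ^ 2 := by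
      calc X t₂ 2 * exp (-(ε⁻¹ * M * β * (t₂ + ΔC - t₂)))
          ≤ 2 * ε * (s₀ + H) * exp (-(ε⁻¹ * M * β * (t₂ + ΔC - t₂))) :=
            mul_le_mul_of_nonneg_right hct₂ (exp_pos _).le
        _ = lam * ρ ^ 2 := by
            rw [hexp, mul_div_assoc', mul_comm (2 * ε * (s₀ + H)), mul_div_assoc, div_self hne,
              mul_one]
    rw [hfloor] at hdecay
    linarith
  exact ⟨t₁, t₂, t₂ + ΔC, h01, h12, by linarith, by linarith, hTH, halive, hb1, hband, hb2, hdead,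
    hcT, harmw, hcpos⟩

end Summit.NavierStokesRegularity.FluidComputer.GateBudget
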